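import Summits.QuantumFields.YangMills.Theses.BalabanLadder
import Literature.MathematicalPhysics.QuantumFieldTheory.Balaban1983to89.GibbsMeasureWilsonDictionary
import Literature.MathematicalPhysics.QuantumLattice.LatticeGaugeDLR
import Literature.MathematicalPhysics.QuantumLattice.LatticeGaugeDLRFreeEnergyProofs
import Literature.MathematicalPhysics.QuantumLattice.RepLieAlgebraUnitary

/-!
# The `UV → UVSeamRec` junction of the spine `BalabanLadder`, read in ONE currency:
# Bałaban's family lattices are EVEN tori; Track A's expectations ARE host Wilson expectations on those tori;
# their thermodynamic-limit states are `infiniteVolumeLimitPoints`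

R136 (iii) OS-ASSEMBLY BOOKKEEPING, seat `ym-osasm-p1` (UV-adapter knitter), `--supports stmt-QuantumFields-19351` (the spine's crux
`UV` = `Summit.QuantumFields.YangMills.Theses.BalabanLadder.UV`), bearing on the junction `hUV → hSeam` of
`BalabanLadder.closes (hUV) (hSeam) (hNT) (hIR) (hROT) (hOther) : YangMills` — concretely on the registered stub
`stub_ceilings : BalabanLadder.UV → MomentBounds6 SU(2) rF uRec` of crux `UVSeamRec` (stmt-QuantumFields-20043,
`Cruxes/UVSeamRec/Lines/birth.lean` v4-F; `rF := fundamentalLatticeRep 2`).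

HONEST FRAMING.  Bookkeeping of a CONDITIONAL chain (0∕6 legs of the spine discharged); nothing here is a continuum-limit, mass-gap or
Clay claim.  Every theorem below is an identity between two typings of ONE finite-volume Wilson expectation, an arithmetic fact about
Bałaban's lattice sizes, or soft bookkeeping of limit states.  No `Prop` is defined; no hypothesis of any item is asserted.

THE JUNCTION FACT RECORDED HERE (for `pub/ym-beyond/ASSEMBLY-CENSUS.md`, hSeam row; located by this seat 2026-08-26).
* Track A's currency — `BalabanLadder.UV` and every decl of `Theses/BalabanUVNodes.lean` — speaks about Bałaban's lattices `F.P K` of a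
  four-torus family `F : T4Family` ([Balaban1987RG1] (0.1) p. 251: the torus is the cube `[−L^m, L^m]^4` with faces identified and the
  `ε = L^{-K}` lattice sits at the half-odd points, so level `j` has `2·L^{m+K−j}` sites per direction; tree `Params.sitesPerDir`,
  `T4Family.sitesPerDir_eq`, `even_sitesPerDir`).  These site counts are EVEN (§1).
* The spine's Y2 currency — `DlrCollarTransfer.torusE G r β S` and through it `MomentBounds6`, `MomentBounds`, `Q2`, `Q3`,
  `LowerBounds`, and `GapInUnits` (`latticeConnectedCorr … (2 * S + 1) …`), all in
  `Theorems/LangevinControlUVOSLegsFromFemtoAndGapDefs.lean` — speaks about the periodic Wilson states on the ODD symmetric tori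
  `(ℤ/(2S+1)ℤ)^4`.
* Hence NO lattice of any family is a torus of the Y2 currency (`family_sitesPerDir_ne_odd`, §1): a proof of `stub_ceilings` cannot
  instantiate its hypothesis `UV` at any torus its conclusion quantifies over, and the «measure dictionary (D0) … on odd tori
  (ℤ/(2L′+1))⁴ at 2L′+1 = L^(K+m)» written into the aside `UVSeam` (stmt-QuantumFields-19352) has no solution `L′`.  What IS an
  identity (§2, from the Literature dictionary `GibbsMeasureWilsonDictionary`, seat ym3-torus-p2): Bałaban's expectation
  `Missing.expect (F.P K) β` — in particular Track A's scheme expectations `(D.scheme g₀).expectAt K` at `β = (g₀ K)⁻²` — equals the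
  host-tree Wilson expectation on the EVEN torus with `(F.P K).sitesPerDir 0 = 2·L^{m+K}` sites per direction, in the fundamental
  representation `fundamentalLatticeRep N` (the `rF` of 20043's v4-F at `N = 2`), at HOST inverse coupling `β / N` (normalised vs.
  un-normalised trace: for `SU(2)` the host coupling is `(g₀ K)⁻² / 2`).
* Parity-free meeting points already in the tree: (a) the DLR-kernel currency `FBL6` (frozen-boundary law on femto cubes — no torus;
  the landed `FloorsEngineOfWindow.momentBounds6_uRec_of_fbl6_commensurable` yields `stub_ceilings`' conclusion from it); (b) the
  infinite-volume currency: limits of Wilson states along the family lattices (torus exponent `m → ∞` at fixed `K`) are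
  `infiniteVolumeLimitPoints` of `LatticeGaugeDLR` (which admits ANY strictly increasing side sequence `L_k + 1`), and §3 reads their
  defining limits in Track A's own `Missing.expect`; they are NOT limits along odd tori, so the odd-torus state family
  `GaugeOSData.oddTorusLimitPoints` (R136 (i) `InfiniteVolume.MomentBounds6TL`) does not see them, `InfiniteVolume.MomentBounds6IV` does.

WHAT THIS IS NOT: not a reshape of any item (one-writer rule); not E0′ (densities ⇒ expectations is untouched); not a claim that
`stub_ceilings` is false — only that, as typed, `UV` reaches it through an un-typed volume ∕ boundary-condition transfer.
References: T. Bałaban, CMP 109 (1987) 249, (0.1) p. 251; CMP 102 (1985) 255, (1)–(2) p. 256; E. Seiler, LNP 159 (1982) Ch. 2.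
-/

open MeasureTheory Filter Topology

namespace Summit.QuantumFields.YangMills.Cruxes.UV.TorusDictionary

open Literature.MathematicalPhysics.QuantumFieldTheory
open Literature.MathematicalPhysics.QuantumFieldTheory.Balaban1983to89
open Literature.MathematicalPhysics.QuantumFieldTheory.Balaban1983to89.T4Continuum
open Literature.MathematicalPhysics.QuantumLattice (fundamentalLatticeRep LGConfig IsCylinder torusLift toTorusObservable
  IsInfiniteVolumeLimitAlong infiniteVolumeLimitPoints)

/-! ## §1 Bałaban's family lattices in numbers: even tori, never a torus of the Y2 currency -/

/-- Level `j` of the `K`-th lattice of the family `F` has `2·L^{m+K−j}` sites per direction ([Balaban1987RG1] (0.1) p. 251; the tree's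
`Params.sitesPerDir` read at `F.P K = params4 L _ m K`). -/
theorem family_sitesPerDir (F : T4Family) (K j : ℕ) : (F.P K).sitesPerDir j = 2 * F.L ^ (F.m + K - j) := rfl

/-- Every lattice of every family has an EVEN number of sites per direction (the tree's `even_sitesPerDir`, read at `F.P K`). -/
theorem even_family_sitesPerDir (F : T4Family) (K j : ℕ) : Even ((F.P K).sitesPerDir j) :=
  even_sitesPerDir (F.P K) j

/-- **THE JUNCTION FACT.**  No lattice of any four-torus family is an odd symmetric torus `(ℤ/(2S+1)ℤ)^4` — the tori on which the
spine's `torusE`, `MomentBounds6`, `Q2`/`Q3`/`LowerBounds` and `GapInUnits` are stated: `(F.P K).sitesPerDir j ≠ 2S+1` for all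
`F, K, j, S`. -/
theorem family_sitesPerDir_ne_odd (F : T4Family) (K j S : ℕ) : (F.P K).sitesPerDir j ≠ 2 * S + 1 := by
  rw [family_sitesPerDir]
  exact Nat.two_mul_ne_two_mul_add_one

/-- The finest lattice in the spine's reading: `2·L^{m+K} ≠ 2S+1` (the form the Y2 predicates would need). -/
theorem two_mul_pow_ne_odd (F : T4Family) (K S : ℕ) : 2 * F.L ^ (F.m + K) ≠ 2 * S + 1 :=
  Nat.two_mul_ne_two_mul_add_one

/-- Conversely no odd torus size is attained: for every `S` and every family the finest lattice misses `2S+1` by at least one site,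
`(F.P K).sitesPerDir 0 = 2S+1` is impossible while `(F.P K).sitesPerDir 0 = 2·(L^{m+K})` always holds (`T4Family.sitesPerDir_eq`). -/
theorem family_sitesPerDir_zero (F : T4Family) (K : ℕ) : (F.P K).sitesPerDir 0 = 2 * F.L ^ (F.m + K) :=
  F.sitesPerDir_eq K

/-- The family lattices have at least `2` (indeed at least `2·12²`) sites per direction; in particular `sitesPerDir 0 − 1 + 1 =
sitesPerDir 0`, the index shift used to present them as sides `L_k + 1` of `IsInfiniteVolumeLimitAlong` (§3). -/
theorem family_sitesPerDir_sub_one_add_one (F : T4Family) (K j : ℕ) :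
    (F.P K).sitesPerDir j - 1 + 1 = (F.P K).sitesPerDir j :=
  Nat.sub_add_cancel (Nat.one_le_iff_ne_zero.mpr ((F.P K).sitesPerDir_ne_zero j))

/-! ## §2 (D0) Track A's expectations are host Wilson expectations on the even torus `2·L^{m+K}`, representation
`fundamentalLatticeRep N`, host coupling `β / N` -/

/-- **D0 AT THE FAMILY LATTICE, MEASURE LEVEL.**  For `β ≥ 0` and every observable `Φ` of the finest lattice `T^{(0)}` of `F.P K` with
values in `SU(N)`: Bałaban's expectation `⟨Φ⟩_{F.P K, β} = Z⁻¹∫ Φ e^{−βA}` (`Missing.expect`, normalised trace) is the host-tree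
Wilson integral on the torus `(ℤ/Mℤ)^4`, `M = (F.P K).sitesPerDir 0 = 2·L^{m+K}` (§1), in the fundamental representation
`(fundamentalLatticeRep N).ρ`, at host inverse coupling `β / N`, read through `ofConfig` (Literature
`GibbsMeasureWilsonDictionary.integral_gibbsMeasure_eq_integral_wilsonMeasure` ∘ `T4GenFunBounds.integral_gibbsMeasure_eq_expect`,
with `(F.P K).d = 4` by `rfl`). [cite: Balaban1985UV3, (1)-(2) p.256] -/
theorem expect_family_eq_integral_wilsonMeasure {N : ℕ} [NeZero N] (F : T4Family) (K : ℕ) {β : ℝ} (hβ : 0 ≤ β)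
    (Φ : GaugeField (F.P K) 0 (Matrix.specialUnitaryGroup (Fin N) ℂ) → ℝ) :
    Missing.expect (F.P K) β Φ =
      ∫ V, Φ (ofConfig (P := F.P K) (j := 0) V)
        ∂(wilsonMeasure (d := 4) (L := (F.P K).sitesPerDir 0) (fundamentalLatticeRep N).ρ (β / N)) :=
  (T4GenFunBounds.integral_gibbsMeasure_eq_expect (F.P K) hβ Φ).symm.trans
    (GibbsMeasureWilsonDictionary.integral_gibbsMeasure_eq_integral_wilsonMeasure (F.P K) hβ Φ)

/-- The same identity with the host `wilsonExpectation` (the symbol of `IsInfiniteVolumeLimitAlong`, `TwoPoint`, `Skewness`):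
`⟨Φ⟩_{F.P K, β} = wilsonExpectation_{(ℤ/Mℤ)^4} (fundamentalLatticeRep N).ρ (β/N) (Φ ∘ ofConfig)`, `M = 2·L^{m+K}`. [cite: Balaban1985UV3, (1)-(2) p.256] -/
theorem expect_family_eq_wilsonExpectation {N : ℕ} [NeZero N] (F : T4Family) (K : ℕ) {β : ℝ} (hβ : 0 ≤ β)
    (Φ : GaugeField (F.P K) 0 (Matrix.specialUnitaryGroup (Fin N) ℂ) → ℝ) :
    Missing.expect (F.P K) β Φ =
      wilsonExpectation (d := 4) (L := (F.P K).sitesPerDir 0) (fundamentalLatticeRep N).ρ (β / N)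
        (fun V => Φ (ofConfig (P := F.P K) (j := 0) V)) :=
  expect_family_eq_integral_wilsonMeasure F K hβ Φ

/-- **D0 FOR AN OBSERVABLE OF THE PERIODIC LIFT.**  For an observable `Ψ` of `ℤ^4` gauge fields, Bałaban's expectation of `Ψ` read on
the finest family lattice through the periodic lift (`Ψ ∘ torusLift M ∘ toConfig`, `M = (F.P K).sitesPerDir 0`) is the host Wilson
expectation of `toTorusObservable M Ψ` — the exact shape of the terms of `IsInfiniteVolumeLimitAlong … (L_k + 1 := M)`. [folklore] -/
theorem expect_family_torusLift_eq_wilsonExpectation {N : ℕ} [NeZero N] (F : T4Family) (K : ℕ) {β : ℝ} (hβ : 0 ≤ β)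
    (Ψ : LGConfig 4 (Matrix.specialUnitaryGroup (Fin N) ℂ) → ℝ) :
    Missing.expect (F.P K) β (fun U => Ψ (torusLift ((F.P K).sitesPerDir 0) (toConfig U))) =
      wilsonExpectation (d := 4) (L := (F.P K).sitesPerDir 0) (fundamentalLatticeRep N).ρ (β / N)
        (toTorusObservable ((F.P K).sitesPerDir 0) Ψ) := by
  rw [expect_family_eq_wilsonExpectation F K hβ]
  rfl

/-- **D0 AT THE SCHEME (Track A's output currency).**  For every finite-ε datum `D` of a family on `SU(N)`, every bare-coupling
sequence `g₀` and every list of loop labels: the scheme expectation `(D.scheme g₀).expectAt K Cs = ⟨∏_{C ∈ Cs} avgObs_K C⟩_{F.P K, (g₀ K)⁻²}`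
(the quantity `ContinuumYM4Torus D` / `HybridNE7Under D …` and hence `BalabanLadder.UV` speak about) is the host Wilson expectation of
the same product on the EVEN torus `M = 2·L^{m+K}`, representation `fundamentalLatticeRep N`, host coupling `(g₀ K)⁻² / N`.  At `N = 2`
this is the spine's `rF` and coupling `(g₀ K)⁻² / 2`; the torus is never a `2S+1` (§1). [cite: Balaban1987RG1, (0.1) p.251] -/
theorem scheme_expectAt_eq_wilsonExpectation {N : ℕ} [NeZero N] {F : T4Family}
    (D : FiniteEpsData F (Matrix.specialUnitaryGroup (Fin N) ℂ)) (g₀ : ℕ → ℝ) (K : ℕ) (Cs : List (ULoop F)) :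
    (D.scheme g₀).expectAt K Cs =
      wilsonExpectation (d := 4) (L := (F.P K).sitesPerDir 0) (fundamentalLatticeRep N).ρ ((g₀ K)⁻¹ ^ 2 / N)
        (fun V => (Cs.map fun C => D.avgObs K C (ofConfig (P := F.P K) (j := 0) V)).prod) :=
  expect_family_eq_wilsonExpectation F K (sq_nonneg _) _

/-- The scheme's inverse coupling at step `K` is Bałaban's `(g₀ K)⁻²` (by `rfl`); the HOST coupling of §2 is its `N`-th part. [folklore] -/
theorem scheme_beta {N : ℕ} [NeZero N] {F : T4Family} (D : FiniteEpsData F (Matrix.specialUnitaryGroup (Fin N) ℂ))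
    (g₀ : ℕ → ℝ) (K : ℕ) : (D.scheme g₀).β K = (g₀ K)⁻¹ ^ 2 := rfl

/-! ## §3 Thermodynamic limits along the family lattices are `infiniteVolumeLimitPoints` (the IV currency), computed by
Track A's own expectations -/

/-- Transport of a torus Wilson expectation of a periodic-lift observable along an equality of torus sizes (the sizes enter the TYPE of
the configuration space; `NeZero` is a `Prop`, so the instances agree). [folklore] -/
theorem wilsonExpectation_toTorusObservable_congr {G : Type*} [Group G] [TopologicalSpace G] [IsTopologicalGroup G]
    [CompactSpace G] [MeasurableSpace G] [BorelSpace G] {N : ℕ} (ρ : G →* Matrix (Fin N) (Fin N) ℂ) (β : ℝ)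
    (Ψ : LGConfig 4 G → ℝ) {M M' : ℕ} [NeZero M] [NeZero M'] (h : M = M') :
    wilsonExpectation (d := 4) (L := M) ρ β (toTorusObservable M Ψ) =
      wilsonExpectation (d := 4) (L := M') ρ β (toTorusObservable M' Ψ) := by
  subst h
  rfl

/-- **FAMILY VOLUMES ARE ADMISSIBLE SIDES.**  Along families with a common block size and strictly increasing torus exponents `m_k`,
the finest-lattice site counts `2·L^{m_k+K}`, shifted by one, form a strictly increasing sequence `L_k` with `L_k + 1 =
((F_k).P K).sitesPerDir 0` — an admissible index for `IsInfiniteVolumeLimitAlong`/`infiniteVolumeLimitPoints` (any parity), though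
never for `GaugeOSData.oddTorusLimitPoints` (sides `2S_k+1`, excluded by §1). [folklore] -/
theorem strictMono_family_sitesPerDir_sub_one {Fk : ℕ → T4Family} {L₀ : ℕ} (hL : ∀ k, (Fk k).L = L₀)
    (hm : StrictMono fun k => (Fk k).m) (K : ℕ) :
    StrictMono fun k => ((Fk k).P K).sitesPerDir 0 - 1 := by
  have hL₀ : 1 < L₀ := by rw [← hL 0]; exact (Fk 0).hL.2
  intro a b hab
  have ha : ((Fk a).P K).sitesPerDir 0 = 2 * L₀ ^ ((Fk a).m + K) := by rw [family_sitesPerDir_zero, hL a]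
  have hb : ((Fk b).P K).sitesPerDir 0 = 2 * L₀ ^ ((Fk b).m + K) := by rw [family_sitesPerDir_zero, hL b]
  have hlt : 2 * L₀ ^ ((Fk a).m + K) < 2 * L₀ ^ ((Fk b).m + K) :=
    Nat.mul_lt_mul_of_pos_left (Nat.pow_lt_pow_right hL₀ (Nat.add_lt_add_right (hm hab) K)) two_pos
  have hone : 1 ≤ 2 * L₀ ^ ((Fk a).m + K) := Nat.one_le_iff_ne_zero.mpr (by positivity)
  show ((Fk a).P K).sitesPerDir 0 - 1 < ((Fk b).P K).sitesPerDir 0 - 1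
  rw [ha, hb]
  omega

/-- **THE DEFINING LIMITS OF A FAMILY-VOLUME LIMIT STATE, IN TRACK A's CURRENCY.**  If `μ` is the infinite-volume limit of the host
Wilson states (representation `fundamentalLatticeRep N`, host coupling `β/N`, `β ≥ 0`) along sides `L_k + 1 = ((F_k).P K).sitesPerDir 0`
— the finest lattices of a sequence of families at a fixed `K` — then for every bounded continuous cylinder observable `Ψ` of `ℤ^4`
gauge fields Bałaban's expectations of its periodic lifts converge to `∫ Ψ dμ`:
`⟨Ψ ∘ torusLift ∘ toConfig⟩_{(F_k).P K, β} → ∫ Ψ dμ`.  (So a route fed by Track A's finite-volume output at fixed `K`, uniform in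
`m`, produces states in `infiniteVolumeLimitPoints`, cf. `mem_infiniteVolumeLimitPoints_of_family`.) [folklore] -/
theorem tendsto_expect_family_of_isInfiniteVolumeLimitAlong {N : ℕ} [NeZero N] (Fk : ℕ → T4Family) (K : ℕ)
    (Lseq : ℕ → ℕ) (hside : ∀ k, ((Fk k).P K).sitesPerDir 0 = Lseq k + 1) {β : ℝ} (hβ : 0 ≤ β)
    {μ : Measure (LGConfig 4 (Matrix.specialUnitaryGroup (Fin N) ℂ))}
    (hμ : IsInfiniteVolumeLimitAlong (d := 4) (fundamentalLatticeRep N).ρ (β / N) Lseq μ)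
    (Ψ : LGConfig 4 (Matrix.specialUnitaryGroup (Fin N) ℂ) → ℝ) (S : Finset (Literature.MathematicalPhysics.QuantumLattice.ZdEdge 4))
    (hcyl : IsCylinder Ψ S) (hcont : Continuous Ψ) (hbdd : ∃ C, ∀ U, |Ψ U| ≤ C) :
    Tendsto (fun k => Missing.expect ((Fk k).P K) β
        (fun U => Ψ (torusLift (((Fk k).P K).sitesPerDir 0) (toConfig U)))) atTop (𝓝 (∫ U, Ψ U ∂μ)) := by
  refine (hμ.2 Ψ S hcyl hcont hbdd).congr' (Eventually.of_forall fun k => ?_)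
  show _ = Missing.expect ((Fk k).P K) β fun U => Ψ (torusLift (((Fk k).P K).sitesPerDir 0) (toConfig U))
  rw [expect_family_torusLift_eq_wilsonExpectation (Fk k) K hβ Ψ]
  exact wilsonExpectation_toTorusObservable_congr _ _ Ψ (hside k).symm

/-- **FAMILY-VOLUME LIMIT STATES ARE INFINITE-VOLUME LIMIT POINTS (IV currency).**  A state obtained as the limit of the host Wilson
states along the finest lattices of families `F_k` with a common block size and strictly increasing torus exponents is an element of
`infiniteVolumeLimitPoints (fundamentalLatticeRep N).ρ (β/N)` — the state family of R136 (i)'s `InfiniteVolume.MomentBounds6IV`; by §1 it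
is not exhibited in `GaugeOSData.oddTorusLimitPoints` (the family of `MomentBounds6TL`) by this sequence. [folklore] -/
theorem mem_infiniteVolumeLimitPoints_of_family {N : ℕ} [NeZero N] {Fk : ℕ → T4Family} {L₀ : ℕ} (hL : ∀ k, (Fk k).L = L₀)
    (hm : StrictMono fun k => (Fk k).m) (K : ℕ) {β' : ℝ}
    {μ : Measure (LGConfig 4 (Matrix.specialUnitaryGroup (Fin N) ℂ))}
    (hμ : IsInfiniteVolumeLimitAlong (d := 4) (fundamentalLatticeRep N).ρ β' (fun k => ((Fk k).P K).sitesPerDir 0 - 1) μ) :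
    μ ∈ infiniteVolumeLimitPoints (d := 4) (fundamentalLatticeRep N).ρ β' :=
  ⟨_, strictMono_family_sitesPerDir_sub_one hL hm K, hμ⟩

/-! ## §4 The spine binder `hUV` read in the symbols of its only consumer `hSeam` -/

/-- **WHAT `hUV : BalabanLadder.UV` HANDS TO `hSeam` (to `stub_ceilings`), IN THE Y2 SYMBOLS.**  From the spine's crux `UV` BY NAME:
on every family `F` the datum `D` it provides (Stage-0 datum of record with (B), endpoint existence and the hybrid-NE7 package) has ALL
its scheme expectations — the numbers its four conjuncts are about — equal to host Wilson expectations
`wilsonExpectation (L := (F.P K).sitesPerDir 0) (fundamentalLatticeRep 2).ρ ((g₀ K)⁻²/2)` on tori whose size `(F.P K).sitesPerDir 0 =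
2·L^{m+K}` is NEVER an odd `2S+1`; i.e. `UV` delivers information about the fundamental `SU(2)` Wilson states on even tori only, while
`MomentBounds6 SU(2) rF uRec` asks about odd tori only.  Consumer-side adapter; no content is added to `UV`. [folklore] -/
theorem uv_scheme_expectations_on_even_tori (hUV : Summit.QuantumFields.YangMills.Theses.BalabanLadder.UV) (F : T4Family) :
    ∃ D : FiniteEpsData F (Matrix.specialUnitaryGroup (Fin 2) ℂ),
      Node00.IsDatumOfRecord₀ F 2 D ∧ B16.EndStatementBPrinted D.C ∧ DagBinding.EndpointExistence D.C.toB12 ∧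
        T4ApexHybrid.HybridNE7Under D (DagBinding.EndpointExistence D.C.toB12) ∧
        (∀ (g₀ : ℕ → ℝ) (K : ℕ) (Cs : List (ULoop F)),
          (D.scheme g₀).expectAt K Cs =
            wilsonExpectation (d := 4) (L := (F.P K).sitesPerDir 0) (fundamentalLatticeRep 2).ρ ((g₀ K)⁻¹ ^ 2 / 2)
              (fun V => (Cs.map fun C => D.avgObs K C (ofConfig (P := F.P K) (j := 0) V)).prod)) ∧
        (∀ K : ℕ, (F.P K).sitesPerDir 0 = 2 * F.L ^ (F.m + K)) ∧
        ∀ K S : ℕ, (F.P K).sitesPerDir 0 ≠ 2 * S + 1 := by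
  obtain ⟨D, h0, hB, hE, hH⟩ := hUV F
  exact ⟨D, h0, hB, hE, hH, fun g₀ K Cs => scheme_expectAt_eq_wilsonExpectation D g₀ K Cs,
    family_sitesPerDir_zero F, fun K S => family_sitesPerDir_ne_odd F K 0 S⟩

/-! ## §5 (D1, elementary part) The Y2 plane field on the periodic lift of a family lattice IS Bałaban's plaquette variable

The spine's `MomentBounds6` integrand is a string of single-plane plaquette fields `DlrCollarTransfer.plane G r q x` evaluated on the
periodic lift `torusLift (2S+1) U` of a torus configuration.  On a FAMILY lattice (even torus `M = (F.P K).sitesPerDir 0`) the same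
field, read through the dictionary `toConfig`, is `N · reTr U(∂p)` — Bałaban's normalised plaquette trace ([Balaban1985Averaging] (9)
p. 19, `GaugeField.plaqHol`) at the plaquette `p = (x mod M; q.1 < q.2)`; and the centred plane-string moments under the host Wilson
state on that torus are Bałaban expectations `Missing.expect (F.P K) β` of the corresponding centred products.  This is the literal
translation an even-torus (parity-agnostic ∕ cofinal-family, repair (c)) variant of `MomentBounds6`, or an E0′ proof from (B), starts
from; on the odd tori of `MomentBounds6` itself there is nothing to translate (§1). -/

open Summit.QuantumFields.YangMills.Cruxes.OSLegsFromFemtoAndGap.DlrCollarTransfer (plane)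

/-- Plaquette holonomies of a translated `ℤ⁴` configuration at the origin are the holonomies at the translation vector:
`(θ_{−x} U)_{(0; i, j)} = U_{(x; i, j)}` (`configShift (-x) U e = U (e.1 + x, e.2)`). [folklore] -/
theorem plaquetteHolonomyZd_configShift_neg_zero {G : Type*} [Group G] [MeasurableSpace G] (x : Fin 4 → ℤ)
    (U : LGConfig 4 G) (i j : Fin 4) :
    Literature.MathematicalPhysics.QuantumLattice.plaquetteHolonomyZd
        (Literature.MathematicalPhysics.QuantumLattice.configShift (-x) U) 0 i j =
      Literature.MathematicalPhysics.QuantumLattice.plaquetteHolonomyZd U x i j := by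
  simp only [Literature.MathematicalPhysics.QuantumLattice.plaquetteHolonomyZd,
    Literature.MathematicalPhysics.QuantumLattice.configShift_apply, sub_neg_eq_add, zero_add, add_comm x]

/-- **D1 (elementary): THE PLANE FIELD ON A FAMILY LATTICE IS `N · reTr U(∂p)`.**  For a configuration `U` of the finest lattice of
`F.P K` with values in `SU(N)`, an orientation `q.1 < q.2` and a base point `x ∈ ℤ⁴`: the Y2 single-plane field of the fundamental
representation, evaluated on the periodic lift of `toConfig U` (period `M = (F.P K).sitesPerDir 0 = 2·L^{m+K}`), equals `N` times
Bałaban's normalised plaquette trace at the plaquette of `T^{(0)}` based at `x mod M`. [cite: Balaban1985Averaging, (9) p.19] -/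
theorem plane_torusLift_toConfig {N : ℕ} [NeZero N] (F : T4Family) (K : ℕ) (q : Fin 4 × Fin 4) (hq : q.1 < q.2)
    (x : Fin 4 → ℤ) (U : GaugeField (F.P K) 0 (Matrix.specialUnitaryGroup (Fin N) ℂ)) :
    plane (Matrix.specialUnitaryGroup (Fin N) ℂ) (fundamentalLatticeRep N) q x
        (torusLift ((F.P K).sitesPerDir 0) (toConfig U)) =
      N * reTr (GaugeField.plaqHol U
        ⟨Literature.Probability.LatticeModels.Torus.proj ((F.P K).sitesPerDir 0) x, q.1, q.2, hq⟩) := by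
  have h1 : Literature.MathematicalPhysics.QuantumLattice.plaquetteHolonomyZd
      (Literature.MathematicalPhysics.QuantumLattice.configShift (-x) (torusLift ((F.P K).sitesPerDir 0) (toConfig U)))
        0 q.1 q.2 =
      GaugeField.plaqHol U ⟨Literature.Probability.LatticeModels.Torus.proj ((F.P K).sitesPerDir 0) x, q.1, q.2, hq⟩ := by
    rw [plaquetteHolonomyZd_configShift_neg_zero,
      Literature.MathematicalPhysics.QuantumLattice.FreeEnergy.plaquetteHolonomyZd_torusLift]
    exact plaquetteHolonomy_toConfig U ⟨_, q.1, q.2, hq⟩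
  have h2 := reTr_mul_card_SU (N := N)
    (GaugeField.plaqHol U ⟨Literature.Probability.LatticeModels.Torus.proj ((F.P K).sitesPerDir 0) x, q.1, q.2, hq⟩)
  unfold plane Literature.MathematicalPhysics.QuantumLattice.plaquetteObs
  rw [h1]
  show ((Literature.MathematicalPhysics.QuantumLattice.fundamentalRep (Fin N) _).trace).re = _
  rw [← h2, mul_comm]

/-- **D0 + D1 ON THE EVEN FAMILY TORUS: centred plane-string moments are Bałaban expectations.**  For `β ≥ 0`, a string of orientations
`q i` (`(q i).1 < (q i).2`), base points `x i ∈ ℤ⁴` and centring constants `c i`: the host Wilson integral (fundamental representation,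
host coupling `β/N`, torus `M = (F.P K).sitesPerDir 0`) of `∏ᵢ (plane (q i) (x i) ∘ torusLift M − c i)` — the shape of the `MomentBounds6`
integrand, but on Bałaban's EVEN torus — equals Bałaban's expectation `⟨∏ᵢ (N·reTr U(∂pᵢ) − c i)⟩_{F.P K, β}`, `pᵢ = (x i mod M; q i)`.
[cite: Balaban1985UV3, (1)-(2) p.256] -/
theorem integral_planeString_family_eq_expect {N : ℕ} [NeZero N] (F : T4Family) (K : ℕ) {β : ℝ} (hβ : 0 ≤ β) {n : ℕ}
    (q : Fin n → Fin 4 × Fin 4) (hq : ∀ i, (q i).1 < (q i).2) (x : Fin n → (Fin 4 → ℤ)) (c : Fin n → ℝ) :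
    ∫ V, ∏ i, (plane (Matrix.specialUnitaryGroup (Fin N) ℂ) (fundamentalLatticeRep N) (q i) (x i)
        (torusLift ((F.P K).sitesPerDir 0) V) - c i)
        ∂(wilsonMeasure (d := 4) (L := (F.P K).sitesPerDir 0) (fundamentalLatticeRep N).ρ (β / N)) =
      Missing.expect (F.P K) β (fun U : GaugeField (F.P K) 0 (Matrix.specialUnitaryGroup (Fin N) ℂ) =>
        ∏ i, ((N : ℝ) * reTr (GaugeField.plaqHol U
          ⟨Literature.Probability.LatticeModels.Torus.proj ((F.P K).sitesPerDir 0) (x i), (q i).1, (q i).2, hq i⟩) - c i)) := by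
  rw [expect_family_eq_integral_wilsonMeasure F K hβ]
  refine integral_congr_ae (Eventually.of_forall fun V => ?_)
  refine Finset.prod_congr rfl fun i _ => ?_
  rw [← plane_torusLift_toConfig F K (q i) (hq i) (x i) (ofConfig (P := F.P K) (j := 0) V), toConfig_ofConfig]

/-- The one-point case: the host Wilson mean of a plane field on the family torus is Bałaban's mean plaquette trace times `N`:
`∫ plane q x ∘ torusLift M dμ_{M, β/N} = ⟨N·reTr U(∂p)⟩_{F.P K, β}`. [cite: Balaban1985UV3, (1)-(2) p.256] -/
theorem integral_plane_family_eq_expect {N : ℕ} [NeZero N] (F : T4Family) (K : ℕ) {β : ℝ} (hβ : 0 ≤ β)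
    (q : Fin 4 × Fin 4) (hq : q.1 < q.2) (x : Fin 4 → ℤ) :
    ∫ V, plane (Matrix.specialUnitaryGroup (Fin N) ℂ) (fundamentalLatticeRep N) q x (torusLift ((F.P K).sitesPerDir 0) V)
        ∂(wilsonMeasure (d := 4) (L := (F.P K).sitesPerDir 0) (fundamentalLatticeRep N).ρ (β / N)) =
      Missing.expect (F.P K) β (fun U : GaugeField (F.P K) 0 (Matrix.specialUnitaryGroup (Fin N) ℂ) =>
        (N : ℝ) * reTr (GaugeField.plaqHol U
          ⟨Literature.Probability.LatticeModels.Torus.proj ((F.P K).sitesPerDir 0) x, q.1, q.2, hq⟩)) := by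
  rw [expect_family_eq_integral_wilsonMeasure F K hβ]
  refine integral_congr_ae (Eventually.of_forall fun V => ?_)
  beta_reduce
  rw [← plane_torusLift_toConfig F K q hq x (ofConfig (P := F.P K) (j := 0) V), toConfig_ofConfig]

/-! ## §6 The seam reaches the SUMMIT STATEMENT: the lattice approximants of `_root_.YangMills` are odd tori too

The spine's conclusion `YangMills` (`Summits/QuantumFields/YangMills/Statement.lean` :72) quantifies `∃ sch : SpeciesScheme (YMSpecies G)`
with `IsYangMillsFor r sch T` and `HasLatticeMassGap r sch Δ` (Literature `YangMillsOS`): the scheme's `k`-th lattice approximant is the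
torus of side `sch.side k := 2 * sch.L k + 1` (`latticeSchwinger … (L := sch.side k)`), and the lattice-gap clause runs over ALL odd tori
`2S+1`, `sch.L k ≤ S`.  So the odd parity is not only the Y2 legs' convention: it is the summit statement's own lattice-approximation
vocabulary, and NO species scheme of the statement runs on a Track A lattice (`speciesScheme_side_ne_family_sitesPerDir`).  Consequence
for the route owner's adopted direction (c′) «class-parametric legs over an unbounded class of RAW sides, 𝓣_A = {2·L^n} produced by the UV
side» (ruling 2026-08-26T18:17Z): a class of EVEN sides cannot be the sides of the statement's scheme; a bridge `yangMills_of_legsOn 𝓣`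
ending in `_root_.YangMills` needs either odd members in `𝓣` cofinally, or a parity-agnostic `SpeciesScheme.side` ∕ `HasLatticeMassGap`
(a STATEMENT-level change, operator ∕ audit pen), or a volume transfer at the very end.  Bookkeeping only. -/

/-- The summit statement's `k`-th lattice approximant is an ODD torus: `sch.side k = 2·L_k + 1`. [folklore] -/
theorem speciesScheme_side_odd {ι : Type} (sch : SpeciesScheme ι) (k : ℕ) : Odd (sch.side k) :=
  ⟨sch.L k, rfl⟩

/-- **NO SPECIES SCHEME OF THE SUMMIT STATEMENT RUNS ON A TRACK A LATTICE**: for every scheme `sch`, step `k`, family `F`, and levels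
`K, j`, `sch.side k ≠ (F.P K).sitesPerDir j` (odd vs `2·L^{m+K−j}`).  Hence the lattice Schwinger functions `latticeSchwinger r.ρ sch …`
of `IsYangMillsFor` and the tori of `HasLatticeMassGap` are never expectations on Bałaban's lattices; whatever `BalabanLadder.UV` delivers
reaches `_root_.YangMills` through a change of torus. [folklore] -/
theorem speciesScheme_side_ne_family_sitesPerDir {ι : Type} (sch : SpeciesScheme ι) (k : ℕ) (F : T4Family) (K j : ℕ) :
    sch.side k ≠ (F.P K).sitesPerDir j :=
  (family_sitesPerDir_ne_odd F K j (sch.L k)).symm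

/-- The tori of the summit statement's lattice-gap clause `HasLatticeMassGap` (`latticeConnectedCorr … (2 * S + 1) …`, all `S ≥ sch.L k`)
are never Track A lattices either: `2S+1 ≠ (F.P K).sitesPerDir j`. [folklore] -/
theorem latticeGap_torus_ne_family_sitesPerDir (S : ℕ) (F : T4Family) (K j : ℕ) : 2 * S + 1 ≠ (F.P K).sitesPerDir j :=
  (family_sitesPerDir_ne_odd F K j S).symm

end Summit.QuantumFields.YangMills.Cruxes.UV.TorusDictionary
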